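import Summits.BirchSwinnertonDyer.BirchSwinnertonDyer.Theorems.ThetaPartnerAtTwoSignedControlAtTwoPlusGenBridgeTwo
import Summits.BirchSwinnertonDyer.BirchSwinnertonDyer.Theorems.ThetaPartnerAtTwoSignedKatoUpToAtTwoLocalTwoPlusPointsLayer
import Summits.BirchSwinnertonDyer.BirchSwinnertonDyer.Theorems.ThetaPartnerAtTwoSignedControlAtTwoPlusHondaTransportNonDiv
import Summits.BirchSwinnertonDyer.Rank1Residual.Additive.KobayashiLayerSaturation
import Literature.NumberTheory.EllipticCurves.Sprung2012.ColemanMapLambdaActionProofs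
import HarnessLib

/-!
# HONDA⁺@2 — the registered stub `stub_plusHondaSystemTwo` of line `eulerchar` v6 (K4 `SignedControlAtTwo`,
# stmt-BirchSwinnertonDyer-20309) PROVED: a plus Honda system on the cyclotomic `ℤ₂`-tower of `ℚ₂` for every globally minimal
# `W/ℚ` with `GoodSS W 2`, `a₂(W) = 0` — the assembly of the K3 lead's points, the K4 lead's plus-tower generation step, the w2
# dictionary and w3's model transport, plus the one remaining cyclotomic identity «the logarithm of the plus Honda point»

Route `ThetaPartnerAtTwo` (TP2; crux shared with `ResidualThetaTransportAtTwo`), crux K4, line `eulerchar` v6 (skeleton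
`Cruxes/SignedControlAtTwo/Lines/eulerchar.lean`, sha16 8d2b4be25f391f24, lead `prover-bsd-wall-tp2-p3` g2); seat `prover-bsd-wall-tp2-p3-w2`
(width seat 2/3, g2). HONEST FRAMING: this closes the STUB `stub_plusHondaSystemTwo` (one of the two stubs of v6; the other is the PUB
conjunction `stub_pubGreenbergTwo` of five Greenberg/Kato named facts) — NOT the crux and NOT BSD; THEOREMS ONLY (no definition, no named
fact, no instance, no `sorry`); route-independent imports (no `Theses` file).

THE ASSEMBLY (memo `Cruxes/SignedControlAtTwo/LAGPLUS-AT-2-CONSTRUCTION.md` §§2,4 made kernel-exact):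
* POINTS, (L), (TR), (NONDIV) — K3 lead's `SignedKatoOffTwo.LocalTwo.plusPointsLayer_two` (files `…SignedKatoUpToAtTwoLocal*` f1–f13):
  tower points `c_m` (`Λ(c_m) = ℓ_m` on the `2`-adic model `M_W`), inverters `σ_m` of `ζ_{2^m}`, `d_n = 3•(c_{n+2} + σ_{n+2}•c_{n+2}) − 2•c_1`,
  stated in Kobayashi's layer currency through the w2 dictionary (`…PlusLayerTwo{,Points}`).
* (GEN) on `E₁` with generator `e_n = c_{n+2} + σ_{n+2}•c_{n+2}` — `SignedEC.PlusLayer.plusGen_kernel_two` (`…PlusGenBridgeTwo`): the K4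
  lead's plus-tower Prop. 8.11 ⇒ 8.12 step `PlusTower.exists_sub_closure_sub_two_smul_plus` (`…PlusGenStepTwo`; tower lemma `(T)`, FROB⁺,
  TGEN, Honda at every prime — `…PlusTower{Two,IntegersTwo,LadderTwo,StepTwo}`, `…OmegaSubfieldDefs`) + the w2 log descent
  (`…PlusLogDescentTwo`) + the bridge «coordinates in `ℚ₂(v_{n+2})` ⟺ `localLayerPointsOfEmb κ ι W n`».
* §1 HERE: **`ell_add_smul_ell_sub_v_mem_adjoin_v`** — the logarithm of the plus Honda point: `ℓ_{m+3} + σ•ℓ_{m+3} − v_{m+3} ∈ ℚ₂(v_{m+2})`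
  for every inverter `σ` of `ζ_{2^{m+3}}` (`ℓ_{m+3} − (ζ − 1) ∈ ℚ₂(ζ_{2^{m+2}})` by `ell_sub_mem_layer_pred`, the `Δ`-trace `t + σt` is
  `σ`-fixed since `σ² ∈ Stab ζ`, and `ℚ₂(ζ_{2^{m+2}})^{σ} = ℚ₂(u_{m+2})` by `…PlusLayerTwoField`) — the hypothesis `heℓ` of the generation step.
* §2 generator change `e_n ↦ d_n` (`3•e_n = d_n + 2•c_1`, `SignedEC.PlusLayer.plusGen_of_plusGen_generator_change`) and odd saturation
  `E₁ → E` (`#Ẽ(𝔽₂) = 3`: `KobayashiLayerSaturation.card_smul_mem_kernel_of_mem_subfieldPoints`, `…natCard_point_eq_of_tr_eq_zero`;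
  `SignedEC.PlusLayer.plusGen_of_plusGen_odd_nsmul`) ⟹ **`plusHondaSystemTwo_padic`**: the four clauses at the model `ℚ_[2]` for EVERY
  `ι : ℚ̄ → ℚ̄₂`.
* §3 w3's model transport `SignedEC.stub_plusHondaSystemTwo_of_padic_nonDiv` (`…PlusHondaTransportNonDiv`; `ℚ_[2] → v.adicCompletion ℚ`,
  (NONDIV) ⟹ (GEN₀) by `…PlusGenZeroOfNonDiv`) ⟹ **`Cruxes.SignedControlAtTwo.EulerChar.stub_plusHondaSystemTwo`**, the REGISTERED
  signature VERBATIM.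
BSD is not proved by any of this; the crux `SignedControlAtTwo` still carries the PUB stub (five printed facts of Greenberg LNM 1716 / Kato).

References: [Kobayashi2003] S. Kobayashi, Invent. Math. 152 (2003), Def. 1.1, §8.4 (Lemma 8.9, Props. 8.7, 8.11, 8.12);
[Sprung2012] F. Sprung, J. Number Theory 132 (2012), Thm. 2.2 (2′) (p. 1487), Lemma 2.3; [KuriharaOtsuki2006] M. Kurihara, R. Otsuki,
p. 557, Prop. 1.4; [Washington1997] §13.1; [SilvermanAEC2009] IV.6.4, VII.2.1–2.2.
-/

set_option autoImplicit false
set_option linter.dupNamespace false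

noncomputable section

open scoped Classical IntermediateField Topology NNReal NumberField

namespace Summit.BirchSwinnertonDyer.BirchSwinnertonDyer.Theorems.SignedEC.PlusLayer

open Field WeierstrassCurve NumberField IsDedekindDomain Literature.NumberTheory.EllipticCurves
  Literature.NumberTheory.GaloisRepresentations
  Literature.NumberTheory.EllipticCurves.ZpExtension Literature.NumberTheory.EllipticCurves.Kobayashi2003
  Literature.NumberTheory.EllipticCurves.FormalGroupChart Literature.NumberTheory.EllipticCurves.Rank1Residual
  Summit.BirchSwinnertonDyer.Rank1Residual.Additive Summit.BirchSwinnertonDyer.Rank1Residual.Additive.PadicCyclotomicTower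
  Summit.BirchSwinnertonDyer.Rank1Residual.Additive.BallEval
  Summit.BirchSwinnertonDyer.BirchSwinnertonDyer.Theorems.SignedKatoOffTwo.LocalTwo


/-! ## §1 The logarithm of the plus Honda point: `ℓ_{m+3} + σ•ℓ_{m+3} ≡ v_{m+3} (mod ℚ₂(v_{m+2}))` -/

/-- **The logarithm of the plus Honda point lies in `v_{m+3} + ℚ₂(v_{m+2})`.** For every `m` and every inverter `σ` of `ζ_{2^{m+3}}`
(`σζ = ζ⁻¹`): `ℓ_{m+3} + σ•ℓ_{m+3} − (ζ_{2^{m+3}} + ζ_{2^{m+3}}⁻¹ − 2) ∈ ℚ_[2]⟮ζ_{2^{m+2}} + ζ_{2^{m+2}}⁻¹ − 2⟯`. With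
`t := ℓ_{m+3} − (ζ − 1) ∈ ℚ₂(ζ_{2^{m+2}})` (`ell_sub_mem_layer_pred`) the left side is the `Δ`-trace `t + σ•t`, which lies in
`ℚ₂(ζ_{2^{m+2}})` and is fixed by `σ` (`σ² ∈ Stab ζ_{2^{m+3}}`), hence lies in the plus field (`…PlusLayerTwoField`,
`mem_adjoin_u_iff_mem_layer_and_smul_eq`; `ℚ₂(u) = ℚ₂(u − 2)`). This is `λ_n ≡ v_n (mod k_{n−1})` of the memo (§2, §4 (iv)).
[cite: Kobayashi2003, Lemma 8.9, Prop. 8.11] [cite: Washington1997, §13.1] -/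
theorem ell_add_smul_ell_sub_v_mem_adjoin_v (m : ℕ) {σ : absoluteGaloisGroup ℚ_[2]}
    (hσ : σ • zeta 2 (m + 3) = (zeta 2 (m + 3))⁻¹) :
    ell 2 (m + 3) + σ • ell 2 (m + 3) - (zeta 2 (m + 3) + (zeta 2 (m + 3))⁻¹ - 2) ∈
      ℚ_[2]⟮zeta 2 (m + 2) + (zeta 2 (m + 2))⁻¹ - 2⟯ := by
  set ζ := zeta 2 (m + 3) with hζ
  set t := ell 2 (m + 3) - (ζ - 1) with ht
  have htL : t ∈ layer 2 (m + 2) := by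
    have h := ell_sub_mem_layer_pred (p := 2) (m := m + 3) (by omega)
    rwa [show m + 3 - 1 = m + 2 by omega] at h
  have htL' : t ∈ layer 2 (m + 3) := layer_mono 2 (by omega) htL
  -- the left side is `t + σ • t`
  have hσ1 : σ • (ζ - 1) = ζ⁻¹ - 1 := by rw [smul_sub, hσ, smul_one]
  have e : ell 2 (m + 3) + σ • ell 2 (m + 3) - (ζ + ζ⁻¹ - 2) = t + σ • t := by
    rw [ht, smul_sub, hσ1]; ring
  rw [e, ← adjoin_u_eq_adjoin_v]
  -- `σ` inverts `ζ_{2^{m+2}} = ζ²` as well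
  have hσ2 : σ • zeta 2 (m + 2) = (zeta 2 (m + 2))⁻¹ := by
    rw [← zeta_succ_pow 2 (m + 2), smul_pow', ← hζ, hσ, inv_pow]
  refine (mem_adjoin_u_iff_mem_layer_and_smul_eq hσ2 _).mpr ⟨add_mem htL (smul_mem_layer σ htL), ?_⟩
  -- `σ • (t + σ • t) = σ • t + t` since `σ² ∈ Stab ζ`
  have hσσ : σ * σ ∈ stab 2 (m + 3) := by
    rw [mem_stab_iff, mul_smul, ← hζ, hσ, smul_inv'', hσ, inv_inv]
  rw [smul_add, ← mul_smul, smul_eq_self_of_mem_stab hσσ htL', add_comm]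

/-! ## §2 The four clauses at the model `ℚ_[2]`, every `ι` -/

/-- **HONDA⁺@2 at the model `ℚ_[2]`, every `ι`, from the parts — modulo (iv).** For `W/ℚ` globally minimal with `GoodSS W 2`,
`a₂(W) = 0`, cyclotomic `κ`, any `ι : ℚ̄ → ℚ̄₂`: ASSUMING (iv) `ell 2 (m+3) + σ • ell 2 (m+3) − v_{m+3} ∈ ℚ₂(v_{m+2})` for every
`m` and every inverter `σ` of `ζ_{2^{m+3}}`, the four clauses (L) (TR) (GEN) (NONDIV) hold for K3's family `d`.
[cite: Kobayashi2003, Def. 1.1, Lemma 8.9, Props. 8.7, 8.11, 8.12] [cite: Sprung2012, Thm. 2.2 (2′)] -/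
theorem plusHondaSystemTwo_padic_of_ellPlus (W : WeierstrassCurve ℚ) [W.IsElliptic] [W.IsGloballyMinimal]
    (hss : GoodSS W 2) (ha : W.frobeniusTrace 2 = 0) (κ : ZpExtension ℚ 2) (hκ : κ.IsCyclotomic)
    (ι : AlgebraicClosure ℚ →ₐ[ℚ] AlgebraicClosure ℚ_[2])
    (hℓ : ∀ (m : ℕ) (σ : absoluteGaloisGroup ℚ_[2]), σ • zeta 2 (m + 3) = (zeta 2 (m + 3))⁻¹ →
      ell 2 (m + 3) + σ • ell 2 (m + 3) - (zeta 2 (m + 3) + (zeta 2 (m + 3))⁻¹ - 2) ∈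
        ℚ_[2]⟮zeta 2 (m + 2) + (zeta 2 (m + 2))⁻¹ - 2⟯) :
    ∃ d : ℕ → localPoints W ℚ_[2],
      (∀ m, d m ∈ localLayerPointsOfEmb κ ι W m) ∧
      (∀ m, localTraceOfEmb κ ι W (m + 1) (m + 2) (d (m + 2)) = -d m) ∧
      (∀ m : ℕ, 1 ≤ m → ∀ P ∈ localLayerPointsOfEmb κ ι W m,
        ∃ B ∈ AddSubgroup.closure (Set.range fun σ : absoluteGaloisGroup ℚ_[2] ↦ σ • d m),
          ∃ P' ∈ localLayerPointsOfEmb κ ι W (m - 1), ∃ R ∈ localLayerPointsOfEmb κ ι W m, P = B + P' + 2 • R) ∧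
      (∀ b ∈ localLayerPointsOfEmb κ ι W 0, d 0 ≠ 2 • b) := by
  obtain ⟨c, σ, d, hcΩ, hcstab, hσ, hd, hL, hTR, hND⟩ := plusPointsLayer_two W hss ha κ hκ ι
  refine ⟨d, hL, hTR, ?_, hND⟩
  intro m hm Q hQ
  obtain ⟨m', rfl⟩ := Nat.exists_eq_add_of_le' hm
  -- the `2`-adic model and its identification with `W ⊗ ℚ̄₂`
  set M : WeierstrassCurve ℤ_[2] := (integralModelInt W).map (Int.castRingHom ℤ_[2]) with hM
  haveI := isElliptic_coe_twoAdicModel W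
  haveI := isElliptic_toZMod_twoAdicModel W hss.1
  haveI hintΩ := isIntegral_genFib_baseChange 2 M
  set hV := (genFibΩ_eq_baseChange M).trans (baseChange_twoAdicModel W) with hVdef
  have htr : Literature.NumberTheory.EllipticCurves.HasseManin.tr (M.map PadicInt.toZMod) = 0 := by
    rw [hM, tr_twoAdicModel W hss.1, ha]
  have h₁ := a₁_twoAdicModel_mem W hss
  have htors : ∀ Q ∈ subfieldPoints (genFibΩ 2 M) (layer 2 (m' + 1 + 2)).toSubfield coeffs_mem_layer,
      ∀ k : ℕ, 2 ^ k • Q = 0 → Q = 0 :=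
    fun Q hQ k hk ↦ eq_zero_of_two_pow_smul_eq_zero_of_mem_subfieldPoints_layer M h₁ _ hQ hk
  set act : absoluteGaloisGroup ℚ_[2] → (genFibΩ 2 M).toAffine.Point → (genFibΩ 2 M).toAffine.Point :=
    fun τ P ↦ (toLoc hV).symm (τ • toLoc hV P) with hact
  -- the plus Honda point `e = c̃ + σ c̃` at level `m' + 3`
  obtain ⟨hcL, hck, hcℓ⟩ := hcΩ (m' + 3)
  set ct := (toLoc hV).symm (c (m' + 3)) with hct
  have hσ3 := hσ (m' + 3) (by omega)
  set e := ct + act (σ (m' + 3)) ct with he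
  have hacte : act (σ (m' + 3)) ct = (toLoc hV).symm (σ (m' + 3) • c (m' + 3)) := by
    rw [hact]; simp only [hct, AddEquiv.apply_symm_apply]
  have he_toLoc : toLoc hV e = c (m' + 3) + σ (m' + 3) • c (m' + 3) := by
    rw [he, map_add, hacte, hct, AddEquiv.apply_symm_apply, AddEquiv.apply_symm_apply]
  have heLayer : toLoc hV e ∈ localLayerPointsOfEmb κ ι W (m' + 1) := by
    rw [he_toLoc]
    exact add_smul_mem_localLayerPointsOfEmb_two_stab W ι hκ hσ3 (hcstab (m' + 3))
  have heL : e ∈ subfieldPoints (genFibΩ 2 M) (ℚ_[2]⟮zeta 2 (m' + 1 + 2) + (zeta 2 (m' + 1 + 2))⁻¹ - 2⟯).toSubfield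
      (PlusTower.coeffs_mem_adjoin M _) := by
    have h := (mem_localLayerPointsOfEmb_two_iff_mem_subfieldPoints_adjoin_v hV ι hκ (m' + 1) (toLoc hV e)).mp heLayer
    rwa [AddEquiv.symm_apply_apply] at h
  have hactL : act (σ (m' + 3)) ct ∈ subfieldPoints (genFibΩ 2 M) (layer 2 (m' + 3)).toSubfield coeffs_mem_layer :=
    act_mem_subfieldPoints act (act_zero hV) (act_some hV) _ hcL
  have hactk : act (σ (m' + 3)) ct ∈ kernel (Valued.v (R := PadicAlgCl 2)) (genFibΩ 2 M) :=
    act_mem_kernel act (act_zero hV) (act_some hV) _ hck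
  have hek : e ∈ kernel (Valued.v (R := PadicAlgCl 2)) (genFibΩ 2 M) :=
    (kernel (Valued.v (R := PadicAlgCl 2)) (genFibΩ 2 M)).add_mem hck hactk
  have heℓ : ptLogΩ 2 M e - (zeta 2 (m' + 1 + 2) + (zeta 2 (m' + 1 + 2))⁻¹ - 2) ∈
      ℚ_[2]⟮zeta 2 (m' + 1 + 1) + (zeta 2 (m' + 1 + 1))⁻¹ - 2⟯ := by
    haveI := isIntegral_curveK 2 (LayerField 2 (m' + 3)) M
    rw [he, ptLogΩ_add (m := m' + 3) hcL hactL hck hactk,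
      ptLogΩ_act act (act_zero hV) (act_some hV) _ (norm_zCoord_lt_one_of_mem_kernel hck), hcℓ]
    exact hℓ m' (σ (m' + 3)) hσ3
  -- `3 • Q` lies in the image of `E₁`
  have hQlayer : (toLoc hV).symm Q ∈ subfieldPoints (genFibΩ 2 M) (layer 2 (m' + 3)).toSubfield coeffs_mem_layer := by
    obtain ⟨τ₀, -, hτ₀⟩ := exists_inverter_mem_localLayerSubgroupOfEmb_two ι hκ (m' + 1)
    exact (forall_smul_eq_iff_mem_subfieldPoints hV (m' + 3) Q).mp
      ((mem_localLayerPointsOfEmb_two_iff_stab W ι hκ hτ₀ Q).mp hQ).1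
  have h3card : Nat.card (M.map PadicInt.toZMod).toAffine.Point = 3 := by
    rw [natCard_point_eq_of_tr_eq_zero M htr]
  have h3Qk : (toLoc hV).symm ((3 : ℕ) • Q) ∈ kernel (Valued.v (R := PadicAlgCl 2)) (genFibΩ 2 M) := by
    have h : Nat.card (M.map PadicInt.toZMod).toAffine.Point • (toLoc hV).symm Q ∈
        kernel (Valued.v (R := PadicAlgCl 2)) (genFibΩ 2 M) :=
      card_smul_mem_kernel_of_mem_subfieldPoints M hQlayer
    rw [h3card, ← map_nsmul] at h
    exact @h
  have h3Qn : toLoc hV ((toLoc hV).symm ((3 : ℕ) • Q)) ∈ localLayerPointsOfEmb κ ι W (m' + 1) := by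
    rw [AddEquiv.apply_symm_apply]; exact AddSubgroup.nsmul_mem _ hQ 3
  -- (GEN) for `3 • Q` with generator `c + σ c`
  obtain ⟨B, hB, P', hP', R, hR, hEq⟩ :=
    plusGen_kernel_two hV ι hκ htr (n := m' + 1) (by omega) htors heL hek heℓ h3Qk h3Qn
  rw [AddEquiv.apply_symm_apply] at hEq
  rw [he_toLoc] at hB
  -- generator change `c + σ c ↦ d = 3 • (c + σ c) − 2 • c 1`, then odd saturation
  have hc1 : c 1 ∈ localLayerPointsOfEmb κ ι W (m' + 1 - 1) := by
    refine localLayerPointsOfEmb_mono κ ι W (Nat.zero_le _) ((mem_localLayerPointsOfEmb_zero_iff κ ι W _).mpr fun τ ↦ ?_)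
    exact hcstab 1 τ (by rw [stab_two_one]; exact Subgroup.mem_top τ)
  have hedc : 3 • (c (m' + 3) + σ (m' + 3) • c (m' + 3)) = d (m' + 1) + 2 • c 1 := by
    rw [hd (m' + 1)]; abel
  have hgen3 := plusGen_of_plusGen_generator_change (G := absoluteGaloisGroup ℚ_[2])
    (H := localLayerPointsOfEmb κ ι W (m' + 1)) (H' := localLayerPointsOfEmb κ ι W (m' + 1 - 1))
    (fun g _ hx ↦ Sprung2012.smul_mem_localLayerPointsOfEmb κ ι W _ g hx) hedc hc1 (AddSubgroup.nsmul_mem _ hQ 3)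
    ⟨B, hB, P', hP', R, hR, hEq⟩
  exact plusGen_of_plusGen_odd_nsmul hQ (by decide : Odd 3) hgen3

/-- **The registered stub `stub_plusHondaSystemTwo` from the parts, modulo (iv)** (w3's transport
`SignedEC.stub_plusHondaSystemTwo_of_padic_nonDiv` applied to the above). [cite: Kobayashi2003, §8.4] -/
theorem stub_plusHondaSystemTwo_of_ellPlus
    (hℓ : ∀ (m : ℕ) (σ : absoluteGaloisGroup ℚ_[2]), σ • zeta 2 (m + 3) = (zeta 2 (m + 3))⁻¹ →
      ell 2 (m + 3) + σ • ell 2 (m + 3) - (zeta 2 (m + 3) + (zeta 2 (m + 3))⁻¹ - 2) ∈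
        ℚ_[2]⟮zeta 2 (m + 2) + (zeta 2 (m + 2))⁻¹ - 2⟯) :
    ∀ (W : WeierstrassCurve ℚ) [W.IsElliptic] [W.IsGloballyMinimal],
      ¬ W.HasCM → W.analyticRank = 0 → GoodSS W 2 → W.frobeniusTrace 2 = 0 →
      ∀ (κ : ZpExtension ℚ 2), κ.IsCyclotomic →
      ∀ (v : HeightOneSpectrum (𝓞 ℚ)), (2 : 𝓞 ℚ) ∈ v.asIdeal →
      ∃ d : ℕ → localPoints W (v.adicCompletion ℚ),
        (∀ m, d m ∈ localLayerPointsOfEmb κ (closureEmb (K := ℚ) (v.adicCompletion ℚ)) W m) ∧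
        (∀ m, localTraceOfEmb κ (closureEmb (K := ℚ) (v.adicCompletion ℚ)) W (m + 1) (m + 2) (d (m + 2)) = -d m) ∧
        (∀ m : ℕ, 1 ≤ m → ∀ P ∈ localLayerPointsOfEmb κ (closureEmb (K := ℚ) (v.adicCompletion ℚ)) W m,
          ∃ B ∈ AddSubgroup.closure (Set.range fun σ : absoluteGaloisGroup (v.adicCompletion ℚ) ↦ σ • d m),
            ∃ P' ∈ localLayerPointsOfEmb κ (closureEmb (K := ℚ) (v.adicCompletion ℚ)) W (m - 1),
            ∃ R ∈ localLayerPointsOfEmb κ (closureEmb (K := ℚ) (v.adicCompletion ℚ)) W m, P = B + P' + 2 • R) ∧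
        (∀ P ∈ localLayerPointsOfEmb κ (closureEmb (K := ℚ) (v.adicCompletion ℚ)) W 0,
          ∃ a : ℤ, ∃ R ∈ localLayerPointsOfEmb κ (closureEmb (K := ℚ) (v.adicCompletion ℚ)) W 0, P = a • d 0 + 2 • R) :=
  SignedEC.stub_plusHondaSystemTwo_of_padic_nonDiv fun W _ _ _ _ hss ha κ hκ ι ↦
    plusHondaSystemTwo_padic_of_ellPlus W hss ha κ hκ ι hℓ


/-- **HONDA⁺@2 at the model `ℚ_[2]`, every `ι`, UNCONDITIONALLY**: for `W/ℚ` globally minimal with `GoodSS W 2` and `a₂(W) = 0`, the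
cyclotomic `κ` and every `ι : ℚ̄ → ℚ̄₂`, the K3 lead's family `d` satisfies (L) (TR) (GEN) (NONDIV) — the hypothesis of w3's
`SignedEC.stub_plusHondaSystemTwo_of_padic_nonDiv`. [cite: Kobayashi2003, §8.4 (Lemma 8.9, Props. 8.7, 8.11, 8.12)]
[cite: Sprung2012, Thm. 2.2 (2′)] [cite: KuriharaOtsuki2006, p. 557] -/
theorem plusHondaSystemTwo_padic (W : WeierstrassCurve ℚ) [W.IsElliptic] [W.IsGloballyMinimal]
    (hss : GoodSS W 2) (ha : W.frobeniusTrace 2 = 0) (κ : ZpExtension ℚ 2) (hκ : κ.IsCyclotomic)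
    (ι : AlgebraicClosure ℚ →ₐ[ℚ] AlgebraicClosure ℚ_[2]) :
    ∃ d : ℕ → localPoints W ℚ_[2],
      (∀ m, d m ∈ localLayerPointsOfEmb κ ι W m) ∧
      (∀ m, localTraceOfEmb κ ι W (m + 1) (m + 2) (d (m + 2)) = -d m) ∧
      (∀ m : ℕ, 1 ≤ m → ∀ P ∈ localLayerPointsOfEmb κ ι W m,
        ∃ B ∈ AddSubgroup.closure (Set.range fun σ : absoluteGaloisGroup ℚ_[2] ↦ σ • d m),
          ∃ P' ∈ localLayerPointsOfEmb κ ι W (m - 1), ∃ R ∈ localLayerPointsOfEmb κ ι W m, P = B + P' + 2 • R) ∧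
      (∀ b ∈ localLayerPointsOfEmb κ ι W 0, d 0 ≠ 2 • b) :=
  plusHondaSystemTwo_padic_of_ellPlus W hss ha κ hκ ι fun m _ hσ ↦ ell_add_smul_ell_sub_v_mem_adjoin_v m hσ

end Summit.BirchSwinnertonDyer.BirchSwinnertonDyer.Theorems.SignedEC.PlusLayer

/-! ## §3 The registered stub, verbatim -/

namespace Summit.BirchSwinnertonDyer.BirchSwinnertonDyer.Cruxes.SignedControlAtTwo.EulerChar

open scoped NumberField
open NumberField IsDedekindDomain Literature.NumberTheory.EllipticCurves Literature.NumberTheory.EllipticCurves.Kobayashi2003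
  Literature.NumberTheory.EllipticCurves.Rank1Residual

/-- **The registered stub `stub_plusHondaSystemTwo` (HONDA⁺@2) of line `eulerchar` v6 of K4 `SignedControlAtTwo`
(stmt-BirchSwinnertonDyer-20309), PROVED** — verbatim signature: on the sub-row `¬CM, r_an = 0, GoodSS W 2, a₂ = 0` (only `GoodSS W 2`
and `a₂ = 0` are used), for the cyclotomic `κ` and the place `v ∋ 2`, a family `d : ℕ → E(ℚ̄_v)` with (L) `d m ∈ E(ℚ_{2,m}·ℚ_v)`, (TR)
`Tr_{m+2/m+1} d_{m+2} = −d_m`, (GEN) generation of each layer modulo the previous one and `2`, (GEN₀) `d_0` generates `E(ℚ_v)/2`.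
`SignedEC.PlusLayer.plusHondaSystemTwo_padic` transported by w3's `SignedEC.stub_plusHondaSystemTwo_of_padic_nonDiv`. The assembly of
the work of seats tp2-p2x (K3 local series), tp2-p3 (plus tower), tp2-p3-w2 (dictionary), tp2-p3-w3 (transport, GEN₀). Kobayashi's
Lemma 8.9 / Props. 8.11–8.12 READ AT `2` on the `ℤ₂`-tower `ℚ_{2,n} = ℚ₂(ζ_{2^{n+2}})⁺` (asserted without proof in Kurihara–Otsuki p. 557;
Sprung's Thm. 2.2 (2′) shape). [cite: Kobayashi2003, Lemma 8.9, Prop. 8.11, Prop. 8.12 (pp. 16–18)] [cite: Sprung2012, Thm. 2.2 (p. 1487)]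
[cite: KuriharaOtsuki2006, p. 557] -/
theorem stub_plusHondaSystemTwo :
    ∀ (W : WeierstrassCurve ℚ) [W.IsElliptic] [W.IsGloballyMinimal],
      ¬ W.HasCM → W.analyticRank = 0 → GoodSS W 2 → W.frobeniusTrace 2 = 0 →
      ∀ (κ : ZpExtension ℚ 2), κ.IsCyclotomic →
      ∀ (v : HeightOneSpectrum (𝓞 ℚ)), (2 : 𝓞 ℚ) ∈ v.asIdeal →
      ∃ d : ℕ → localPoints W (v.adicCompletion ℚ),
        (∀ m, d m ∈ localLayerPointsOfEmb κ (closureEmb (K := ℚ) (v.adicCompletion ℚ)) W m) ∧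
        (∀ m, localTraceOfEmb κ (closureEmb (K := ℚ) (v.adicCompletion ℚ)) W (m + 1) (m + 2) (d (m + 2)) = -d m) ∧
        (∀ m : ℕ, 1 ≤ m → ∀ P ∈ localLayerPointsOfEmb κ (closureEmb (K := ℚ) (v.adicCompletion ℚ)) W m,
          ∃ B ∈ AddSubgroup.closure (Set.range fun σ : Field.absoluteGaloisGroup (v.adicCompletion ℚ) ↦ σ • d m),
            ∃ P' ∈ localLayerPointsOfEmb κ (closureEmb (K := ℚ) (v.adicCompletion ℚ)) W (m - 1),
            ∃ R ∈ localLayerPointsOfEmb κ (closureEmb (K := ℚ) (v.adicCompletion ℚ)) W m, P = B + P' + 2 • R) ∧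
        (∀ P ∈ localLayerPointsOfEmb κ (closureEmb (K := ℚ) (v.adicCompletion ℚ)) W 0,
          ∃ a : ℤ, ∃ R ∈ localLayerPointsOfEmb κ (closureEmb (K := ℚ) (v.adicCompletion ℚ)) W 0, P = a • d 0 + 2 • R) :=
  Summit.BirchSwinnertonDyer.BirchSwinnertonDyer.Theorems.SignedEC.stub_plusHondaSystemTwo_of_padic_nonDiv
    fun W _ _ _ _ hss ha κ hκ ι ↦
      Summit.BirchSwinnertonDyer.BirchSwinnertonDyer.Theorems.SignedEC.PlusLayer.plusHondaSystemTwo_padic W hss ha κ hκ ι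

end Summit.BirchSwinnertonDyer.BirchSwinnertonDyer.Cruxes.SignedControlAtTwo.EulerChar

end
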